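import Summits.QuantumFields.YangMills.Theorems.QuantileBitRingChain
import HarnessLib

/-!
# Disjoint slice events on the `n+1`-ring cannot outweigh `Z_phys(n+1)` (D-0145 LINE g12-B, support for ⟨stmt-QuantumFields-23948⟩)

Ring-length-general version of `ToronSmallBallAnnuliSum` (p688325), on top of the ring lemmas of `QuantileBitRingChain`:
for pairwise disjoint measurable slice-`0` events `A_k`, `Σ_k ringInsTrace L β n 𝟙_{A_k} 0 ≤ physTraceSucc L β n`; corollary on the
temperature-`1/L` ring (`n = L-1`): the annuli `{|polDist − kδ| ≤ β^{-γc}}`, `k = 1..K`, `δ > 2β^{-γc}` weigh at most `physTrace L β L`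
in total — the (Σ)-lemma of the planner's skeleton `bc/g12-B/X1B_birth.lean` for the crux `QuantileBitPurity.HolonomyQuantileSubQuartic`
(line «paired covariant sheet translates»).  No summit is proved.
-/

open MeasureTheory Filter Topology Real Function
open scoped Matrix ComplexConjugate BigOperators
open Literature.MathematicalPhysics.QuantumLattice
open Literature.MathematicalPhysics.QuantumFieldTheory hiding SU2
open Summit.QuantumFields.YangMills.Theorems

namespace Summit.QuantumFields.YangMills.Theorems.FemtoTransferGap.TT

open Summit.QuantumFields.YangMills.Theorems.FemtoTransferGap
open Summit.QuantumFields.YangMills.Theorems.FemtoTransferGap.FlatSheet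

variable {L : ℕ} [NeZero L]

/-- ★ Pairwise disjoint measurable slice events cannot outweigh `Z_phys(n+1) = physTraceSucc L β n` (`β ≥ 0`). [folklore] -/
theorem sum_ringInsTrace_indicator_zero_le {β : ℝ} (hβ : 0 ≤ β) (n : ℕ) {ι : Type*} (s : Finset ι)
    (A : ι → Set (GaugeConfig 3 L SU2)) (hA : ∀ k ∈ s, MeasurableSet (A k))
    (hdisj : ∀ k ∈ s, ∀ k' ∈ s, k ≠ k' → Disjoint (A k) (A k')) :
    ∑ k ∈ s, ringInsTrace L β n ((A k).indicator fun _ => (1 : ℝ)) 0 ≤ physTraceSucc L β n := by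
  classical
  have hpt : ∀ U : GaugeConfig 3 L SU2, ∑ k ∈ s, (A k).indicator (fun _ => (1 : ℝ)) U ≤ 1 := by
    intro U
    by_cases h : ∃ k ∈ s, U ∈ A k
    · obtain ⟨k₀, hk₀, hU⟩ := h
      rw [Finset.sum_eq_single_of_mem k₀ hk₀ (fun k hk hne => ?_)]
      · rw [Set.indicator_of_mem hU]
      · exact Set.indicator_of_notMem (fun hU' => (hdisj k hk k₀ hk₀ hne).le_bot ⟨hU', hU⟩) _
    · push Not at h
      rw [Finset.sum_eq_zero (fun k hk => Set.indicator_of_notMem (h k hk) _)]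
      exact zero_le_one
  have hint1 : Integrable (fun Us : Fin (n + 1) → GaugeConfig 3 L SU2 =>
      (∏ i : Fin n, transferKernel su2Rep β (Us i.castSucc) (Us i.succ)) *
        physAvg (transferKernel su2Rep β (Us (Fin.last n))) (Us 0))
      (Measure.pi fun _ : Fin (n + 1) => configMeasure SU2 L) := by
    have h := integrable_ringChain_mul_indicator (L := L) hβ n MeasurableSet.univ
    simpa only [Set.indicator_univ, mul_one] using h
  simp_rw [ringInsTrace_indicator_zero]
  rw [← integral_finsetSum s (fun k hk => integrable_ringChain_mul_indicator hβ n (hA k hk))]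
  unfold physTraceSucc
  refine integral_mono (integrable_finsetSum s fun k hk => integrable_ringChain_mul_indicator hβ n (hA k hk)) hint1 fun Us => ?_
  have h0 := ringChain_nonneg β n Us
  dsimp only
  rw [← Finset.mul_sum]
  calc _ ≤ (∏ i : Fin n, transferKernel su2Rep β (Us i.castSucc) (Us i.succ)) *
        physAvg (transferKernel su2Rep β (Us (Fin.last n))) (Us 0) * 1 := mul_le_mul_of_nonneg_left (hpt (Us 0)) h0
    _ = _ := mul_one _

/-- `physTrace L β L = physTraceSucc L β (L-1)` (definitional). -/
theorem physTrace_self_eq (β : ℝ) : physTrace L β L = physTraceSucc L β (L - 1) := rfl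

/-- ★ **The annuli sum on the temperature-`1/L` ring**: for `β ≥ 1`, `δ > 2β^{-γc}`,
`Σ_{k=1}^{K} ringInsTrace L β (L-1) 𝟙{|polDist − kδ| ≤ β^{-γc}} 0 ≤ Z_phys(L, β, L)`. [folklore] -/
theorem sum_ringInsTrace_annuli_le_physTrace (β : ℝ) (hβ : 1 ≤ β) (γc δ : ℝ) (hδ : 2 * β ^ (-γc) < δ) (K : ℕ) :
    ∑ k ∈ Finset.Icc 1 K, ringInsTrace L β (L - 1)
        (Set.indicator {U : GaugeConfig 3 L SU2 | |polDist U - k * δ| ≤ β ^ (-γc)} fun _ => (1 : ℝ)) 0 ≤ physTrace L β L := by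
  have hβ0 : 0 ≤ β := by linarith
  have hρ : 0 < β ^ (-γc) := Real.rpow_pos_of_pos (by linarith) _
  have hδ0 : 0 < δ := by linarith
  rw [physTrace_self_eq]
  refine sum_ringInsTrace_indicator_zero_le hβ0 (L - 1) (Finset.Icc 1 K)
    (fun k : ℕ => {U : GaugeConfig 3 L SU2 | |polDist U - k * δ| ≤ β ^ (-γc)}) (fun k _ => ?_) (fun k _ k' _ hne => ?_)
  · exact measurableSet_le ((isPhys_polDist.measurable.sub measurable_const).abs) measurable_const
  · rw [Set.disjoint_left]
    intro U hU hU'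
    simp only [Set.mem_setOf_eq] at hU hU'
    have hkk : |((k : ℝ) - k') * δ| ≤ 2 * β ^ (-γc) := by
      have : ((k : ℝ) - k') * δ = (polDist U - k' * δ) - (polDist U - k * δ) := by ring
      rw [this]
      exact (abs_sub _ _).trans (by linarith)
    have hlt : |((k : ℝ) - k')| * δ < δ := by
      rw [← abs_of_pos hδ0, ← abs_mul, abs_of_pos hδ0]; linarith
    have h1 : |((k : ℝ) - k')| < 1 := by
      by_contra hc; push Not at hc; nlinarith
    have hne' : (k : ℤ) ≠ k' := by exact_mod_cast hne
    have hge : (1 : ℝ) ≤ |((k : ℝ) - k')| := by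
      have : (1 : ℤ) ≤ |(k : ℤ) - k'| := Int.one_le_abs (sub_ne_zero.2 hne')
      have h' : ((1 : ℤ) : ℝ) ≤ ((|(k : ℤ) - k'| : ℤ) : ℝ) := by exact_mod_cast this
      simpa [Int.cast_abs, Int.cast_sub] using h'
    linarith

end Summit.QuantumFields.YangMills.Theorems.FemtoTransferGap.TT
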